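import Summits.QuantumFields.YangMills.Theorems.BalabanUVNodesN19ClassSandwichRoad
import Summits.QuantumFields.YangMills.Theorems.BalabanUVNodesN19CoreTVInvariant
import Summits.QuantumFields.YangMills.Theorems.BalabanUVNodesN19MGFFormAtRecord
import Literature.MathematicalPhysics.QuantumFieldTheory.Balaban1983to89.T4RunLadder

/-!
# BalabanUVNodes ∕ N19 (NE7 proper) — ROAD (iii) AT THE RECORD's KEYS: `UnitFactorisation.fac` ALONE keys every level (`prodObs S k os = prodW ∘ A_k`), the two-key
# collapse of n19-c's `core_of_classSandwich` to ONE unit-lattice observable, and ★ the knit with this seat's MODULE B (`…N19MGFFormAtRecord`, p494399 ∕ v1.1 p497235):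
# the dressed `Spine.NE7.Core` FOR F3's CLASS WEIGHTS `classWeightOfDatum₉` from NE7-S_cl on the two class measures of slots pushed to the unit lattice — lens decomp v7 ROW CD-KEYS-REC

Cell `pub-ymgap` (HUMAN RULING D-0062, Track A), R134 ACCELERATION seat `pub-ymgap-dag-n19-d` (strategy s2 «by-name knit at the record»), gen 7, module 26.  Lens decomp v7
(`ym-lens-BalabanUVNodes-decomp/LENS-decomp.md` v7, [LENS-DECOMP-V7] INBOX l.16660 05:11Z, M28 ∕ F5; ROW CD-KEYS-REC «→ dag-n19-d g7: lift sketch v7 §A (:44–:165) into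
`Thm/BalabanUVNodesN19ClassSandwichAtRecord.lean` … add the θ₁₂-of-record ∕ live-selector faces by swapping `_of_ppSelId` for :192 ∕ :339; value: road (iii)'s N19 face at the record BY
NAME modulo `hS`; size S; zero estimate content (say so)»; sketch `lean/LensDecompNE7v7.sketch.lean` §A farm rc 0) — §A LIFTED HERE decl by decl (CREDITED; `prodW` INLINED as
`fun u => (os.map fun o => N.W o u).prod` so the file stays theorems-only), plus §4 the three further faces of MODULE B the row names.  Filed `--kind proof --supports
stmt-QuantumFields-19912 --as helper` (K3‴ `SpineGivenEndpointR13`; lane per lens V63 until dag-lead's KEY line).  COUNT-NEUTRAL.  THEOREMS ONLY; no Theses import; edits nothing.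

WHY (lens v7 M28).  n19-c's landed unit-lattice collapse `N19ClassSandwichRoad.core_of_classSandwich_atUnit` (p496221 §4) is keyed `(K, K+1)` through `NestedFactorisation.nest`; MODULE B's
class weights are keyed by ARBITRARY run parameters `(pK K).K`.  `UnitFactorisation.fac : obs k o = W o ∘ A k` ALONE gives `prodObs S k os = (∏_{o ∈ os} W o) ∘ A k` at EVERY level, so ANY
two key levels collapse to one `φ` on `X` — no `nest`, no `B K` — and the record knit is one term: two `exact`s of `mgfForm_classWeightOfDatum₉_of_ppSelId` into `core_of_classSandwich`.
* §1 `prodObs_eq_prodW_comp_A` · `abs_prodW_le_one` · `measurable_prodW` (the `obsVec_eq_comp` analogue for `prodObs`, absent from the tree).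
* §2 `core_of_classSandwich_map₂` — ROAD (iii), TWO KEYS: two runs on their OWN field spaces read to ONE `X` by any measurable key maps; NE7-S_cl (spelled out) for the pushed-forward
  class measures ⇒ dressed `Core` for every `t` (`core_of_classSandwich` + ne1 gen 2 `MGFForm.map`).
* §3 `core_of_classSandwich_atKeys` — at general key LEVELS `kA kB : ℕ → ℕ` of ONE scheme with a unit factorisation: MODULE B's output shape verbatim.
* §4 ★ AT THE RECORD: `core_classWeightOfDatum₉_of_classSandwich` (identity selector, laws displayed) · `…_of_classSandwich_of_localBg` (laws from NODE 00's rows (H-U), ζ-measurable,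
  `0 ≤ ζ`, `|ζ| ≤ 1`) · `…_of_classSandwich_theta12OfRecord` (at the K0′ witness `θ₀`, ONE displayed hypothesis (H-U)) · `…_of_classSandwich_of_ppSelLive` (director-ym №114 (α) LIVE selector,
  `gK K 0 = g₀ (pK K).K`): two runs of the record keyed by `pA pB : ℕ → RunParams`, the CANONICAL unit factorisation `T4RunLadder.unitFactorisation D hD g₀` of the datum's scheme, and
  NE7-S_cl for the two CLASS MEASURES OF SLOTS pushed to `GaugeField (F.P 0) 0 (SU N)` by `A_{(pA K).K}` ∕ `A_{(pB K).K}` ⇒ the dressed `Spine.NE7.Core` for `classWeightOfDatum₉`, every `t`.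

HONEST FRAMING.  ZERO ESTIMATE CONTENT: `hS` (NE7-S_cl at the record's keys — the class-level measure sandwich modulo constants of the two runs' dressed class measures) is road (iii)'s
whole residual, an UNPRINTED two-run statement for d = 4 (lens v6 F3 ∕ v7 F4 ∕ V65: read off DENS_cl⁰, produced by nobody; [Balaban1985UV3] (41) p.266 ∕ (47) p.267 print the Z-level for
d = 3); order arithmetic on measures and integrals; every sandwich is a HYPOTHESIS SHAPE; nothing of Bałaban's instantiated; NE7 ∕ NE1′ NOT PROVED; N19 NOT discharged (0∕1); K3‴ NOT
claimed; counts UNMOVED (typed 28∕28 · discharged 5∕27, A 5∕28); one finite four-torus programme at fixed `ε = L^{−K}` — NOT ℝ⁴, NOT infinite volume, NOT OS, NOT a mass gap, NOT Clay.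
0 `def`; 0 `sorry`; standard axioms; no decl below carries a cite tag.
-/

set_option autoImplicit false

noncomputable section

open MeasureTheory ProbabilityTheory
open scoped ENNReal Matrix.Norms.L2Operator

namespace Summit.QuantumFields.YangMills.BalabanUVNodes.N19ClassSandwichAtRecord

open Summit.QuantumFields.BalabanUV.T4Continuum.NE1p.DressedMGFForm (tiltedMean MGFForm TiltedMeanMatching)
open Summit.QuantumFields.BalabanUV.T4Continuum.Spine.NE7 (Core)
open Summit.QuantumFields.YangMills.BalabanUVNodes.N19ClassSandwichRoad
open Literature.MathematicalPhysics.QuantumFieldTheory.Balaban1983to89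

/-! ## §1–§3 CD-KEYS: road (iii) at general run keys (lens v7 sketch §A, lifted decl by decl) -/

section Keys

variable {G O : Type*} {S : Missing.TorusScheme G O} [MeasurableSpace G] {X : Type*} [MeasurableSpace X]

/-- **`prodObs S k os = prodW ∘ A_k`** with `prodW := fun u ↦ ∏_{o ∈ os} W_o(u)` INLINED (theorems-only file; lens v7 sketch §A's `def prodW`), for ANY unit factorisation `N` of the scheme (field `fac` alone): the product observable of
record at EVERY level `k` is ONE unit-lattice function read through the level's key map. [folklore] -/
theorem prodObs_eq_prodW_comp_A (N : T4VarianceMatching.UnitFactorisation S X) (k : ℕ) (os : List O) :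
    T4GenFunBounds.prodObs S k os = (fun u => (os.map fun o => N.W o u).prod) ∘ N.A k := by
  funext U
  simp only [T4GenFunBounds.prodObs, Function.comp_apply]
  congr 1
  exact List.map_congr_left fun o _ => N.fac k o U

/-- `|prodW| ≤ 1` (`abs_W_le_one`; `prodW` inlined).  Lens v7 sketch §A, lifted. [folklore] -/
theorem abs_prodW_le_one (N : T4VarianceMatching.UnitFactorisation S X) (os : List O) (u : X) :
    |(os.map fun o => N.W o u).prod| ≤ 1 := by
  induction os with
  | nil => simp
  | cons o os ih =>
    rw [List.map_cons, List.prod_cons, abs_mul]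
    exact mul_le_one₀ (N.abs_W_le_one o u) (abs_nonneg _) ih

/-- `prodW` is measurable (`measurable_W`; inlined).  Lens v7 sketch §A, lifted. [folklore] -/
theorem measurable_prodW (N : T4VarianceMatching.UnitFactorisation S X) (os : List O) :
    Measurable fun u : X => (os.map fun o => N.W o u).prod := by
  induction os with
  | nil => simp
  | cons o os ih =>
    show Measurable fun u : X => N.W o u * (os.map fun o => N.W o u).prod
    exact (N.measurable_W o).mul ih

end Keys

section TwoKeys

variable {X : Type*} [MeasurableSpace X] {ΩA ΩB : ℕ → Type*} [∀ K, MeasurableSpace (ΩA K)] [∀ K, MeasurableSpace (ΩB K)]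
  {ι : Type*} [DecidableEq ι] {l₀ vol B : ℝ} {T : ℕ → Finset ι} {Bad : ℕ → ℝ → Finset ι} {φ : X → ℝ}
  {a : ∀ K, ΩA K → X} {b : ∀ K, ΩB K → X}
  {νA : ∀ K, ι → Measure (ΩA K)} {νB : ∀ K, ι → Measure (ΩB K)} {P Q : ℕ → ℝ → ι → ℝ} {r δ : ℕ → ℝ}

/-- **ROAD (iii), TWO KEYS** (CD-KEYS): two runs on their OWN field spaces `ΩA K`, `ΩB K`, read to ONE space `X` by ANY measurable key maps
`a K`, `b K`; dressed class terms = MGFs of ONE `φ : X → ℝ` (`|φ| ≤ B`) read through the keys; NE7-S_cl (spelled out) for the PUSHED-FORWARD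
class measures on `X`, width `r K ≤ vol·δ K` ⇒ dressed `Core` for every `t`.  (`core_of_classSandwich_atUnit` is the case `ΩA K = Ω_K`,
`ΩB K = Ω_{K+1}`, `a K = A_K`, `b K = A_{K+1}`; MODULE B's keys `(pK K).K` are general.)  Landed `core_of_classSandwich` + ne1 gen 2
`MGFForm.map`. [folklore] -/
theorem core_of_classSandwich_map₂ (ha : ∀ K, Measurable (a K)) (hb : ∀ K, Measurable (b K)) (hφ : Measurable φ)
    (hφb : ∀ u, |φ u| ≤ B) (hP : MGFForm B T (fun K => φ ∘ a K) νA P) (hQ : MGFForm B T (fun K => φ ∘ b K) νB Q)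
    (hS : ∀ K : ℕ, ∃ c : ℝ, ∀ t : ℝ, |t| ≤ l₀ → ∀ τ ∈ T K \ Bad K t,
      ENNReal.ofReal (Real.exp (c - r K)) • (νA K τ).map (a K) ≤ (νB K τ).map (b K) ∧
        (νB K τ).map (b K) ≤ ENNReal.ofReal (Real.exp (c + r K)) • (νA K τ).map (a K))
    (hr : ∀ K, r K ≤ vol * δ K) : Core l₀ vol T Bad P Q δ :=
  core_of_classSandwich (Ω := fun _ => X) (μA := fun K τ => (νA K τ).map (a K)) (μB := fun K τ => (νB K τ).map (b K))
    (MGFForm.map ha hφ hφb hP) (MGFForm.map hb hφ hφb hQ) hS hr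

end TwoKeys

section AtKeys

variable {G O : Type*} {S : Missing.TorusScheme G O} [MeasurableSpace G] {X : Type*} [MeasurableSpace X]
  {ι : Type*} [DecidableEq ι] {l₀ vol : ℝ} {T : ℕ → Finset ι} {Bad : ℕ → ℝ → Finset ι}
  {kA kB : ℕ → ℕ} {νA : ∀ K, ι → Measure (GaugeField (S.P (kA K)) 0 G)} {νB : ∀ K, ι → Measure (GaugeField (S.P (kB K)) 0 G)}
  {P Q : ℕ → ℝ → ι → ℝ} {r δ : ℕ → ℝ}

/-- **ROAD (iii) AT GENERAL KEY LEVELS** — dag-n19-d MODULE B's output shape verbatim: `MGFForm 1 T (fun K => prodObs S (kA K) os) νA P` and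
`MGFForm 1 T (fun K => prodObs S (kB K) os) νB Q` at ANY key levels `kA kB : ℕ → ℕ` (e.g. `kA K = (pA K).K`), a unit factorisation `N`
(tree: `T4RunLadder.unitFactorisation`), and NE7-S_cl for the class measures pushed to the unit lattice by `N.A (kA K)` ∕ `N.A (kB K)` ⇒
dressed `Core`.  (`prodObs_eq_prodW_comp_A` + `core_of_classSandwich_map₂`.) [folklore] -/
theorem core_of_classSandwich_atKeys (N : T4VarianceMatching.UnitFactorisation S X) (os : List O)
    (hP : MGFForm 1 T (fun K => T4GenFunBounds.prodObs S (kA K) os) νA P)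
    (hQ : MGFForm 1 T (fun K => T4GenFunBounds.prodObs S (kB K) os) νB Q)
    (hS : ∀ K : ℕ, ∃ c : ℝ, ∀ t : ℝ, |t| ≤ l₀ → ∀ τ ∈ T K \ Bad K t,
      ENNReal.ofReal (Real.exp (c - r K)) • (νA K τ).map (N.A (kA K)) ≤ (νB K τ).map (N.A (kB K)) ∧
        (νB K τ).map (N.A (kB K)) ≤ ENNReal.ofReal (Real.exp (c + r K)) • (νA K τ).map (N.A (kA K)))
    (hr : ∀ K, r K ≤ vol * δ K) : Core l₀ vol T Bad P Q δ := by
  have hA : (fun K => T4GenFunBounds.prodObs S (kA K) os) = fun K => (fun u => (os.map fun o => N.W o u).prod) ∘ N.A (kA K) :=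
    funext fun K => prodObs_eq_prodW_comp_A N (kA K) os
  have hB : (fun K => T4GenFunBounds.prodObs S (kB K) os) = fun K => (fun u => (os.map fun o => N.W o u).prod) ∘ N.A (kB K) :=
    funext fun K => prodObs_eq_prodW_comp_A N (kB K) os
  rw [hA] at hP; rw [hB] at hQ
  exact core_of_classSandwich_map₂ (ΩA := fun K => GaugeField (S.P (kA K)) 0 G) (ΩB := fun K => GaugeField (S.P (kB K)) 0 G)
    (a := fun K => N.A (kA K)) (b := fun K => N.A (kB K)) (fun K => N.measurable_A (kA K)) (fun K => N.measurable_A (kB K))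
    (measurable_prodW N os) (abs_prodW_le_one N os) hP hQ hS hr

end AtKeys

/-! ## §4 ★ At the record's keys: the knit with MODULE B (`…N19MGFFormAtRecord`) — two `exact`s per face -/

section AtRecord

open Literature.MathematicalPhysics.QuantumFieldTheory.Balaban1983to89.Node00
open T4Continuum B14.Eq218Concrete
open Summit.QuantumFields.YangMills.BalabanUVNodes.N19MGFKernelTower (classMeasureOfSlots)
open Summit.QuantumFields.YangMills.BalabanUVNodes.N19MGFFormAtRecord (mgfForm_classWeightOfDatum₉_of_ppSelId mgfForm_classWeightOfDatum₉_of_localBg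
  mgfForm_classWeightOfDatum₉_theta12OfRecord mgfForm_classWeightOfDatum₉_of_ppSelLive)

variable {F : T4Family} {N : ℕ} [NeZero N] {ι : Type*} [DecidableEq ι] {l₀ vol : ℝ} {Bad : ℕ → ℝ → Finset ι} {r δ : ℕ → ℝ}

/-- **ROAD (iii) AT THE RECORD's KEYS — the knit with dag-n19-d MODULE B is two `exact`s** (p494399 `mgfForm_classWeightOfDatum₉_of_ppSelId`,
at the identity selector): two runs of the record keyed by `pA pB : ℕ → RunParams` (slot data `gA kA eA` ∕ `gB kB eB`), the CANONICAL unit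
factorisation `T4RunLadder.unitFactorisation D hD g₀` of the datum's scheme, and NE7-S_cl for the two CLASS MEASURES OF SLOTS pushed to the unit
lattice `GaugeField (F.P 0) 0 (SU N)` by `A_{(pA K).K}` ∕ `A_{(pB K).K}` ⇒ the dressed `Spine.NE7.Core` for the record's class weights
`classWeightOfDatum₉`, every `t`.  ZERO estimate content: `hS` is road (iii)'s residual (produced by nobody — lens v6 F3 ∕ v7 F4). [folklore] -/
theorem core_classWeightOfDatum₉_of_classSandwich (ϑ : Stage9Params F N) (hsel : ϑ.ppSel = ppSelIdOfRecord F ϑ.ν ϑ.τ9.M)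
    (hw0 : ∀ p g k s' U V', 0 ≤ wOfRecord₉ F N ϑ p g k s' U V') (hw1 : ∀ p g k s' U V', wOfRecord₉ F N ϑ p g k s' U V' ≤ 1)
    (hwm : ∀ (p : B12.RunParams) (g : ℕ → ℝ) k s',
      Measurable fun z : GaugeField (F.P p.K) (k + 1) (SU N) × GaugeField (F.P p.K) k (SU N) => wOfRecord₉ F N ϑ p g k s' z.2 z.1)
    (hχm : ∀ (p : B12.RunParams) (g : ℕ → ℝ) k s, Measurable (chiSeqOfRecord F N ϑ.ν ϑ.τ9.M g p.K k s))
    (D : FiniteEpsData F (SU N)) (hD : D.AvgMeasurable) (g₀ : ℕ → ℝ) (os : List (ULoop F))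
    (pA pB : ℕ → B12.RunParams) (gA gB : ℕ → ℕ → ℝ) (kA kB : ℕ → ℕ) (T : ℕ → Finset ι)
    (eA : ∀ K, ι → SeqOfRecord F ϑ.ν ϑ.τ9.M (gA K) (pA K).K (kA K)) (eB : ∀ K, ι → SeqOfRecord F ϑ.ν ϑ.τ9.M (gB K) (pB K).K (kB K))
    (hS : ∀ K : ℕ, ∃ c : ℝ, ∀ t : ℝ, |t| ≤ l₀ → ∀ τ ∈ T K \ Bad K t,
      ENNReal.ofReal (Real.exp (c - r K)) •
          (classMeasureOfSlots F N ϑ.ν ϑ.τ9 (wOfRecord₉ F N ϑ) (pA K) (gA K) (Missing.boltzmann (F.P (pA K).K) ((g₀ (pA K).K)⁻¹ ^ 2))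
            (kA K) (eA K τ)).map ((T4RunLadder.unitFactorisation D hD g₀).A (pA K).K) ≤
        (classMeasureOfSlots F N ϑ.ν ϑ.τ9 (wOfRecord₉ F N ϑ) (pB K) (gB K) (Missing.boltzmann (F.P (pB K).K) ((g₀ (pB K).K)⁻¹ ^ 2))
            (kB K) (eB K τ)).map ((T4RunLadder.unitFactorisation D hD g₀).A (pB K).K) ∧
      (classMeasureOfSlots F N ϑ.ν ϑ.τ9 (wOfRecord₉ F N ϑ) (pB K) (gB K) (Missing.boltzmann (F.P (pB K).K) ((g₀ (pB K).K)⁻¹ ^ 2))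
            (kB K) (eB K τ)).map ((T4RunLadder.unitFactorisation D hD g₀).A (pB K).K) ≤
        ENNReal.ofReal (Real.exp (c + r K)) •
          (classMeasureOfSlots F N ϑ.ν ϑ.τ9 (wOfRecord₉ F N ϑ) (pA K) (gA K) (Missing.boltzmann (F.P (pA K).K) ((g₀ (pA K).K)⁻¹ ^ 2))
            (kA K) (eA K τ)).map ((T4RunLadder.unitFactorisation D hD g₀).A (pA K).K))
    (hr : ∀ K, r K ≤ vol * δ K) :
    Core l₀ vol T Bad (fun K t τ => classWeightOfDatum₉ F N ϑ D g₀ os (pA K) (gA K) (kA K) t (eA K τ))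
      (fun K t τ => classWeightOfDatum₉ F N ϑ D g₀ os (pB K) (gB K) (kB K) t (eB K τ)) δ :=
  core_of_classSandwich_atKeys (T4RunLadder.unitFactorisation D hD g₀) os
    (mgfForm_classWeightOfDatum₉_of_ppSelId ϑ hsel hw0 hw1 hwm hχm D hD g₀ os pA gA kA T eA)
    (mgfForm_classWeightOfDatum₉_of_ppSelId ϑ hsel hw0 hw1 hwm hχm D hD g₀ os pB gB kB T eB) hS hr

/-- **… WITH THE LAWS FROM NODE 00's ROWS** [bookkeeping] (MODULE B `mgfForm_classWeightOfDatum₉_of_localBg` in place of `_of_ppSelId`): identity selector, (H-U) `LocalBgMeasurable ϑ.ν`,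
`ZetaMeasurable ϑ.ζ`, `0 ≤ ζ`, `|ζ| ≤ 1` — the displayed `w`∕`χ` laws discharged. [folklore] -/
theorem core_classWeightOfDatum₉_of_classSandwich_of_localBg (ϑ : Stage9Params F N) (hsel : ϑ.ppSel = ppSelIdOfRecord F ϑ.ν ϑ.τ9.M)
    (hU : LocalBgMeasurable F N ϑ.ν) (hζm : ZetaMeasurable F N ϑ.ζ) (hζ0 : ∀ p g k s Pl Ql RS U V', 0 ≤ ϑ.ζ p g k s Pl Ql RS U V')
    (hζ1 : IsZetaAbsLeOne F N ϑ.ν ϑ.τ9.M ϑ.ζ) (D : FiniteEpsData F (SU N)) (hD : D.AvgMeasurable) (g₀ : ℕ → ℝ) (os : List (ULoop F))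
    (pA pB : ℕ → B12.RunParams) (gA gB : ℕ → ℕ → ℝ) (kA kB : ℕ → ℕ) (T : ℕ → Finset ι)
    (eA : ∀ K, ι → SeqOfRecord F ϑ.ν ϑ.τ9.M (gA K) (pA K).K (kA K)) (eB : ∀ K, ι → SeqOfRecord F ϑ.ν ϑ.τ9.M (gB K) (pB K).K (kB K))
    (hS : ∀ K : ℕ, ∃ c : ℝ, ∀ t : ℝ, |t| ≤ l₀ → ∀ τ ∈ T K \ Bad K t,
      ENNReal.ofReal (Real.exp (c - r K)) •
          (classMeasureOfSlots F N ϑ.ν ϑ.τ9 (wOfRecord₉ F N ϑ) (pA K) (gA K) (Missing.boltzmann (F.P (pA K).K) ((g₀ (pA K).K)⁻¹ ^ 2))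
            (kA K) (eA K τ)).map ((T4RunLadder.unitFactorisation D hD g₀).A (pA K).K) ≤
        (classMeasureOfSlots F N ϑ.ν ϑ.τ9 (wOfRecord₉ F N ϑ) (pB K) (gB K) (Missing.boltzmann (F.P (pB K).K) ((g₀ (pB K).K)⁻¹ ^ 2))
            (kB K) (eB K τ)).map ((T4RunLadder.unitFactorisation D hD g₀).A (pB K).K) ∧
      (classMeasureOfSlots F N ϑ.ν ϑ.τ9 (wOfRecord₉ F N ϑ) (pB K) (gB K) (Missing.boltzmann (F.P (pB K).K) ((g₀ (pB K).K)⁻¹ ^ 2))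
            (kB K) (eB K τ)).map ((T4RunLadder.unitFactorisation D hD g₀).A (pB K).K) ≤
        ENNReal.ofReal (Real.exp (c + r K)) •
          (classMeasureOfSlots F N ϑ.ν ϑ.τ9 (wOfRecord₉ F N ϑ) (pA K) (gA K) (Missing.boltzmann (F.P (pA K).K) ((g₀ (pA K).K)⁻¹ ^ 2))
            (kA K) (eA K τ)).map ((T4RunLadder.unitFactorisation D hD g₀).A (pA K).K))
    (hr : ∀ K, r K ≤ vol * δ K) :
    Core l₀ vol T Bad (fun K t τ => classWeightOfDatum₉ F N ϑ D g₀ os (pA K) (gA K) (kA K) t (eA K τ))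
      (fun K t τ => classWeightOfDatum₉ F N ϑ D g₀ os (pB K) (gB K) (kB K) t (eB K τ)) δ :=
  core_of_classSandwich_atKeys (T4RunLadder.unitFactorisation D hD g₀) os
    (mgfForm_classWeightOfDatum₉_of_localBg ϑ hsel hU hζm hζ0 hζ1 D hD g₀ os pA gA kA T eA)
    (mgfForm_classWeightOfDatum₉_of_localBg ϑ hsel hU hζm hζ0 hζ1 D hD g₀ os pB gB kB T eB) hS hr

/-- **★ AT THE K0′ WITNESS `θ₀ = theta12OfRecord F N (zeta316OfRecord F N numerics7OfRecord₁₂ 1 1) Rz Zt`** [bookkeeping] (MODULE B :192 `mgfForm_classWeightOfDatum₉_theta12OfRecord`, both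
runs): identity selector by `theta12OfRecord_ppSel` (`rfl`), ζ-laws by K0b — ONE displayed hypothesis (H-U) and road (iii)'s residual `hS`. [folklore] -/
theorem core_classWeightOfDatum₉_of_classSandwich_theta12OfRecord (hU : LocalBgMeasurable F N numerics7OfRecord₁₂)
    (Rz : (K : ℕ) → Sect2.Residual (F.P K) (MatA N)) (Zt : (K : ℕ) → TkResidualW F N (FluctV N) K)
    (D : FiniteEpsData F (SU N)) (hD : D.AvgMeasurable) (g₀ : ℕ → ℝ) (os : List (ULoop F))
    (pA pB : ℕ → B12.RunParams) (gA gB : ℕ → ℕ → ℝ) (kA kB : ℕ → ℕ) (T : ℕ → Finset ι)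
    (eA : ∀ K, ι → SeqOfRecord F numerics7OfRecord₁₂ 1 (gA K) (pA K).K (kA K)) (eB : ∀ K, ι → SeqOfRecord F numerics7OfRecord₁₂ 1 (gB K) (pB K).K (kB K))
    (hS : letI ϑ := (theta12OfRecord F N (zeta316OfRecord F N numerics7OfRecord₁₂ 1 1) Rz Zt).toStage9Params
      ∀ K : ℕ, ∃ c : ℝ, ∀ t : ℝ, |t| ≤ l₀ → ∀ τ ∈ T K \ Bad K t,
      ENNReal.ofReal (Real.exp (c - r K)) •
          (classMeasureOfSlots F N ϑ.ν ϑ.τ9 (wOfRecord₉ F N ϑ) (pA K) (gA K) (Missing.boltzmann (F.P (pA K).K) ((g₀ (pA K).K)⁻¹ ^ 2))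
            (kA K) (eA K τ)).map ((T4RunLadder.unitFactorisation D hD g₀).A (pA K).K) ≤
        (classMeasureOfSlots F N ϑ.ν ϑ.τ9 (wOfRecord₉ F N ϑ) (pB K) (gB K) (Missing.boltzmann (F.P (pB K).K) ((g₀ (pB K).K)⁻¹ ^ 2))
            (kB K) (eB K τ)).map ((T4RunLadder.unitFactorisation D hD g₀).A (pB K).K) ∧
      (classMeasureOfSlots F N ϑ.ν ϑ.τ9 (wOfRecord₉ F N ϑ) (pB K) (gB K) (Missing.boltzmann (F.P (pB K).K) ((g₀ (pB K).K)⁻¹ ^ 2))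
            (kB K) (eB K τ)).map ((T4RunLadder.unitFactorisation D hD g₀).A (pB K).K) ≤
        ENNReal.ofReal (Real.exp (c + r K)) •
          (classMeasureOfSlots F N ϑ.ν ϑ.τ9 (wOfRecord₉ F N ϑ) (pA K) (gA K) (Missing.boltzmann (F.P (pA K).K) ((g₀ (pA K).K)⁻¹ ^ 2))
            (kA K) (eA K τ)).map ((T4RunLadder.unitFactorisation D hD g₀).A (pA K).K))
    (hr : ∀ K, r K ≤ vol * δ K) :
    Core l₀ vol T Bad
      (fun K t τ => classWeightOfDatum₉ F N (theta12OfRecord F N (zeta316OfRecord F N numerics7OfRecord₁₂ 1 1) Rz Zt).toStage9Params D g₀ os (pA K) (gA K) (kA K) t (eA K τ))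
      (fun K t τ => classWeightOfDatum₉ F N (theta12OfRecord F N (zeta316OfRecord F N numerics7OfRecord₁₂ 1 1) Rz Zt).toStage9Params D g₀ os (pB K) (gB K) (kB K) t (eB K τ))
      δ :=
  core_of_classSandwich_atKeys (T4RunLadder.unitFactorisation D hD g₀) os
    (mgfForm_classWeightOfDatum₉_theta12OfRecord hU Rz Zt D hD g₀ os pA gA kA T eA)
    (mgfForm_classWeightOfDatum₉_theta12OfRecord hU Rz Zt D hD g₀ os pB gB kB T eB) hS hr

/-- **… AT A LIVE SELECTOR** [bookkeeping] (director-ym №114 (α); MODULE B v1.1 :339 `mgfForm_classWeightOfDatum₉_of_ppSelLive` in place of `_of_ppSelId`; lens v7 V67: same class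
measures, one extra binder per run `gX K 0 = g₀ (pX K).K`). [folklore] -/
theorem core_classWeightOfDatum₉_of_classSandwich_of_ppSelLive (ϑ : Stage9Params F N) (E : B12.RunParams → ℝ)
    (hsel : ϑ.ppSel = ppSelLiveOfRecord F N ϑ.ν ϑ.τ9 E (wOfRecord₉ F N ϑ))
    (hw0 : ∀ p g k s' U V', 0 ≤ wOfRecord₉ F N ϑ p g k s' U V') (hw1 : ∀ p g k s' U V', wOfRecord₉ F N ϑ p g k s' U V' ≤ 1)
    (hwm : ∀ (p : B12.RunParams) (g : ℕ → ℝ) k s',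
      Measurable fun z : GaugeField (F.P p.K) (k + 1) (SU N) × GaugeField (F.P p.K) k (SU N) => wOfRecord₉ F N ϑ p g k s' z.2 z.1)
    (hχm : ∀ (p : B12.RunParams) (g : ℕ → ℝ) k s, Measurable (chiSeqOfRecord F N ϑ.ν ϑ.τ9.M g p.K k s))
    (D : FiniteEpsData F (SU N)) (hD : D.AvgMeasurable) (g₀ : ℕ → ℝ) (os : List (ULoop F))
    (pA pB : ℕ → B12.RunParams) (gA gB : ℕ → ℕ → ℝ) (hgA : ∀ K, gA K 0 = g₀ (pA K).K) (hgB : ∀ K, gB K 0 = g₀ (pB K).K) (kA kB : ℕ → ℕ)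
    (T : ℕ → Finset ι)
    (eA : ∀ K, ι → SeqOfRecord F ϑ.ν ϑ.τ9.M (gA K) (pA K).K (kA K)) (eB : ∀ K, ι → SeqOfRecord F ϑ.ν ϑ.τ9.M (gB K) (pB K).K (kB K))
    (hS : ∀ K : ℕ, ∃ c : ℝ, ∀ t : ℝ, |t| ≤ l₀ → ∀ τ ∈ T K \ Bad K t,
      ENNReal.ofReal (Real.exp (c - r K)) •
          (classMeasureOfSlots F N ϑ.ν ϑ.τ9 (wOfRecord₉ F N ϑ) (pA K) (gA K) (Missing.boltzmann (F.P (pA K).K) ((g₀ (pA K).K)⁻¹ ^ 2))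
            (kA K) (eA K τ)).map ((T4RunLadder.unitFactorisation D hD g₀).A (pA K).K) ≤
        (classMeasureOfSlots F N ϑ.ν ϑ.τ9 (wOfRecord₉ F N ϑ) (pB K) (gB K) (Missing.boltzmann (F.P (pB K).K) ((g₀ (pB K).K)⁻¹ ^ 2))
            (kB K) (eB K τ)).map ((T4RunLadder.unitFactorisation D hD g₀).A (pB K).K) ∧
      (classMeasureOfSlots F N ϑ.ν ϑ.τ9 (wOfRecord₉ F N ϑ) (pB K) (gB K) (Missing.boltzmann (F.P (pB K).K) ((g₀ (pB K).K)⁻¹ ^ 2))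
            (kB K) (eB K τ)).map ((T4RunLadder.unitFactorisation D hD g₀).A (pB K).K) ≤
        ENNReal.ofReal (Real.exp (c + r K)) •
          (classMeasureOfSlots F N ϑ.ν ϑ.τ9 (wOfRecord₉ F N ϑ) (pA K) (gA K) (Missing.boltzmann (F.P (pA K).K) ((g₀ (pA K).K)⁻¹ ^ 2))
            (kA K) (eA K τ)).map ((T4RunLadder.unitFactorisation D hD g₀).A (pA K).K))
    (hr : ∀ K, r K ≤ vol * δ K) :
    Core l₀ vol T Bad (fun K t τ => classWeightOfDatum₉ F N ϑ D g₀ os (pA K) (gA K) (kA K) t (eA K τ))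
      (fun K t τ => classWeightOfDatum₉ F N ϑ D g₀ os (pB K) (gB K) (kB K) t (eB K τ)) δ :=
  core_of_classSandwich_atKeys (T4RunLadder.unitFactorisation D hD g₀) os
    (mgfForm_classWeightOfDatum₉_of_ppSelLive ϑ E hsel hw0 hw1 hwm hχm D hD g₀ os pA gA hgA kA T eA)
    (mgfForm_classWeightOfDatum₉_of_ppSelLive ϑ E hsel hw0 hw1 hwm hχm D hD g₀ os pB gB hgB kB T eB) hS hr

end AtRecord

/-! ## §5 (v1.1, APPEND-ONLY) The same junction in dag-n19-c's MASS_cl ∧ TV_cl currency (`…N19CoreTVInvariant` p504410 `core_of_mass_of_tv`; n19-c g8 OFFER (o1) l.17083) -/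

section MassTV

open Summit.QuantumFields.YangMills.BalabanUVNodes.N19CoreTVInvariant (core_of_mass_of_tv)

variable {X : Type*} [MeasurableSpace X] {ΩA ΩB : ℕ → Type*} [∀ K, MeasurableSpace (ΩA K)] [∀ K, MeasurableSpace (ΩB K)]
  {ι : Type*} [DecidableEq ι] {l₀ vol B : ℝ} {T : ℕ → Finset ι} {Bad : ℕ → ℝ → Finset ι} {φ : X → ℝ}
  {a : ∀ K, ΩA K → X} {b : ∀ K, ΩB K → X}
  {νA : ∀ K, ι → Measure (ΩA K)} {νB : ∀ K, ι → Measure (ΩB K)} {P Q : ℕ → ℝ → ι → ℝ} {r₁ ρ δ : ℕ → ℝ}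

/-- **ROAD (iii)′, TWO KEYS, MASS ∧ TV** [bookkeeping]: as `core_of_classSandwich_map₂`, with NE7-S_cl replaced by dag-n19-c's support-tolerant pair — MASS_cl(`r₁`) of the
pushed-forward class masses and TV_cl(`ρ`) of the normalised pushed-forward class laws on measurable sets — and the width budget `r₁ K + (e^{2 l₀ B} − 1)·ρ K ≤ vol·δ K`
(`N19CoreTVInvariant.core_of_mass_of_tv` + ne1 `MGFForm.map`). [folklore] -/
theorem core_of_mass_of_tv_map₂ (ha : ∀ K, Measurable (a K)) (hb : ∀ K, Measurable (b K)) (hφ : Measurable φ)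
    (hφb : ∀ u, |φ u| ≤ B) (hP : MGFForm B T (fun K => φ ∘ a K) νA P) (hQ : MGFForm B T (fun K => φ ∘ b K) νB Q)
    (hM : ∀ K : ℕ, ∃ c : ℝ, ∀ t : ℝ, |t| ≤ l₀ → ∀ τ ∈ T K \ Bad K t,
      ENNReal.ofReal (Real.exp (c - r₁ K)) * ((νA K τ).map (a K)) Set.univ ≤ ((νB K τ).map (b K)) Set.univ ∧
        ((νB K τ).map (b K)) Set.univ ≤ ENNReal.ofReal (Real.exp (c + r₁ K)) * ((νA K τ).map (a K)) Set.univ)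
    (hTV : ∀ (K : ℕ) (t : ℝ), |t| ≤ l₀ → ∀ τ ∈ T K \ Bad K t, ∀ S : Set X, MeasurableSet S →
      |((νB K τ).map (b K)).real S / ((νB K τ).map (b K)).real Set.univ - ((νA K τ).map (a K)).real S / ((νA K τ).map (a K)).real Set.univ| ≤ ρ K)
    (hw : ∀ K, r₁ K + (Real.exp (2 * (l₀ * B)) - 1) * ρ K ≤ vol * δ K) : Core l₀ vol T Bad P Q δ :=
  core_of_mass_of_tv (Ω := fun _ => X) (μA := fun K τ => (νA K τ).map (a K)) (μB := fun K τ => (νB K τ).map (b K))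
    (MGFForm.map ha hφ hφb hP) (MGFForm.map hb hφ hφb hQ) hM hTV hw

end MassTV

section MassTVAtRecord

open Literature.MathematicalPhysics.QuantumFieldTheory.Balaban1983to89.Node00
open T4Continuum B14.Eq218Concrete
open Summit.QuantumFields.YangMills.BalabanUVNodes.N19MGFKernelTower (classMeasureOfSlots)
open Summit.QuantumFields.YangMills.BalabanUVNodes.N19MGFFormAtRecord (mgfForm_classWeightOfDatum₉_of_ppSelId)

variable {F : T4Family} {N : ℕ} [NeZero N] {ι : Type*} [DecidableEq ι] {l₀ vol : ℝ} {Bad : ℕ → ℝ → Finset ι} {r₁ ρ δ : ℕ → ℝ}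

/-- **★ ROAD (iii)′ AT THE RECORD's KEYS IN THE MASS ∧ TV CURRENCY** [bookkeeping] (dag-n19-c g8 OFFER (o1): «`core_classWeightOfDatum₉_of_mass_of_tv` — p500938 §4 pattern, `hS` ↦
MASS_cl + TV_cl»): two runs of the record keyed by `pA pB`, MODULE B's MGF forms at the identity selector, the canonical `T4RunLadder.unitFactorisation D hD g₀`, and for the two CLASS
MEASURES OF SLOTS pushed to the unit lattice: MASS_cl(`r₁`) of their masses + TV_cl(`ρ`) of their normalised laws on measurable sets + `r₁ K + (e^{2 l₀} − 1)·ρ K ≤ vol·δ K` ⇒ the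
dressed `Spine.NE7.Core` for `classWeightOfDatum₉` (`B = 1`).  ZERO estimate content: MASS_cl and TV_cl are the residual (lens MS-SPLIT ∕ n19-c: TV is support-tolerant). [folklore] -/
theorem core_classWeightOfDatum₉_of_mass_of_tv (ϑ : Stage9Params F N) (hsel : ϑ.ppSel = ppSelIdOfRecord F ϑ.ν ϑ.τ9.M)
    (hw0 : ∀ p g k s' U V', 0 ≤ wOfRecord₉ F N ϑ p g k s' U V') (hw1 : ∀ p g k s' U V', wOfRecord₉ F N ϑ p g k s' U V' ≤ 1)
    (hwm : ∀ (p : B12.RunParams) (g : ℕ → ℝ) k s',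
      Measurable fun z : GaugeField (F.P p.K) (k + 1) (SU N) × GaugeField (F.P p.K) k (SU N) => wOfRecord₉ F N ϑ p g k s' z.2 z.1)
    (hχm : ∀ (p : B12.RunParams) (g : ℕ → ℝ) k s, Measurable (chiSeqOfRecord F N ϑ.ν ϑ.τ9.M g p.K k s))
    (D : FiniteEpsData F (SU N)) (hD : D.AvgMeasurable) (g₀ : ℕ → ℝ) (os : List (ULoop F))
    (pA pB : ℕ → B12.RunParams) (gA gB : ℕ → ℕ → ℝ) (kA kB : ℕ → ℕ) (T : ℕ → Finset ι)
    (eA : ∀ K, ι → SeqOfRecord F ϑ.ν ϑ.τ9.M (gA K) (pA K).K (kA K)) (eB : ∀ K, ι → SeqOfRecord F ϑ.ν ϑ.τ9.M (gB K) (pB K).K (kB K))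
    (hM : ∀ K : ℕ, ∃ c : ℝ, ∀ t : ℝ, |t| ≤ l₀ → ∀ τ ∈ T K \ Bad K t,
      ENNReal.ofReal (Real.exp (c - r₁ K)) *
          ((classMeasureOfSlots F N ϑ.ν ϑ.τ9 (wOfRecord₉ F N ϑ) (pA K) (gA K) (Missing.boltzmann (F.P (pA K).K) ((g₀ (pA K).K)⁻¹ ^ 2))
            (kA K) (eA K τ)).map ((T4RunLadder.unitFactorisation D hD g₀).A (pA K).K)) Set.univ ≤
        ((classMeasureOfSlots F N ϑ.ν ϑ.τ9 (wOfRecord₉ F N ϑ) (pB K) (gB K) (Missing.boltzmann (F.P (pB K).K) ((g₀ (pB K).K)⁻¹ ^ 2))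
            (kB K) (eB K τ)).map ((T4RunLadder.unitFactorisation D hD g₀).A (pB K).K)) Set.univ ∧
      ((classMeasureOfSlots F N ϑ.ν ϑ.τ9 (wOfRecord₉ F N ϑ) (pB K) (gB K) (Missing.boltzmann (F.P (pB K).K) ((g₀ (pB K).K)⁻¹ ^ 2))
            (kB K) (eB K τ)).map ((T4RunLadder.unitFactorisation D hD g₀).A (pB K).K)) Set.univ ≤
        ENNReal.ofReal (Real.exp (c + r₁ K)) *
          ((classMeasureOfSlots F N ϑ.ν ϑ.τ9 (wOfRecord₉ F N ϑ) (pA K) (gA K) (Missing.boltzmann (F.P (pA K).K) ((g₀ (pA K).K)⁻¹ ^ 2))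
            (kA K) (eA K τ)).map ((T4RunLadder.unitFactorisation D hD g₀).A (pA K).K)) Set.univ)
    (hTV : ∀ (K : ℕ) (t : ℝ), |t| ≤ l₀ → ∀ τ ∈ T K \ Bad K t, ∀ S : Set (GaugeField (F.P 0) 0 (SU N)), MeasurableSet S →
      |((classMeasureOfSlots F N ϑ.ν ϑ.τ9 (wOfRecord₉ F N ϑ) (pB K) (gB K) (Missing.boltzmann (F.P (pB K).K) ((g₀ (pB K).K)⁻¹ ^ 2))
            (kB K) (eB K τ)).map ((T4RunLadder.unitFactorisation D hD g₀).A (pB K).K)).real S /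
          ((classMeasureOfSlots F N ϑ.ν ϑ.τ9 (wOfRecord₉ F N ϑ) (pB K) (gB K) (Missing.boltzmann (F.P (pB K).K) ((g₀ (pB K).K)⁻¹ ^ 2))
            (kB K) (eB K τ)).map ((T4RunLadder.unitFactorisation D hD g₀).A (pB K).K)).real Set.univ -
        ((classMeasureOfSlots F N ϑ.ν ϑ.τ9 (wOfRecord₉ F N ϑ) (pA K) (gA K) (Missing.boltzmann (F.P (pA K).K) ((g₀ (pA K).K)⁻¹ ^ 2))
            (kA K) (eA K τ)).map ((T4RunLadder.unitFactorisation D hD g₀).A (pA K).K)).real S /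
          ((classMeasureOfSlots F N ϑ.ν ϑ.τ9 (wOfRecord₉ F N ϑ) (pA K) (gA K) (Missing.boltzmann (F.P (pA K).K) ((g₀ (pA K).K)⁻¹ ^ 2))
            (kA K) (eA K τ)).map ((T4RunLadder.unitFactorisation D hD g₀).A (pA K).K)).real Set.univ| ≤ ρ K)
    (hw : ∀ K, r₁ K + (Real.exp (2 * (l₀ * 1)) - 1) * ρ K ≤ vol * δ K) :
    Core l₀ vol T Bad (fun K t τ => classWeightOfDatum₉ F N ϑ D g₀ os (pA K) (gA K) (kA K) t (eA K τ))
      (fun K t τ => classWeightOfDatum₉ F N ϑ D g₀ os (pB K) (gB K) (kB K) t (eB K τ)) δ := by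
  have hA : (fun K => T4GenFunBounds.prodObs (D.scheme g₀) (pA K).K os) =
      fun K => (fun u => (os.map fun o => (T4RunLadder.unitFactorisation D hD g₀).W o u).prod) ∘ (T4RunLadder.unitFactorisation D hD g₀).A (pA K).K :=
    funext fun K => prodObs_eq_prodW_comp_A (T4RunLadder.unitFactorisation D hD g₀) (pA K).K os
  have hB : (fun K => T4GenFunBounds.prodObs (D.scheme g₀) (pB K).K os) =
      fun K => (fun u => (os.map fun o => (T4RunLadder.unitFactorisation D hD g₀).W o u).prod) ∘ (T4RunLadder.unitFactorisation D hD g₀).A (pB K).K :=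
    funext fun K => prodObs_eq_prodW_comp_A (T4RunLadder.unitFactorisation D hD g₀) (pB K).K os
  have hP := mgfForm_classWeightOfDatum₉_of_ppSelId ϑ hsel hw0 hw1 hwm hχm D hD g₀ os pA gA kA T eA
  have hQ := mgfForm_classWeightOfDatum₉_of_ppSelId ϑ hsel hw0 hw1 hwm hχm D hD g₀ os pB gB kB T eB
  rw [hA] at hP; rw [hB] at hQ
  exact core_of_mass_of_tv_map₂ (ΩA := fun K => GaugeField (F.P (pA K).K) 0 (SU N)) (ΩB := fun K => GaugeField (F.P (pB K).K) 0 (SU N))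
    (a := fun K => (T4RunLadder.unitFactorisation D hD g₀).A (pA K).K) (b := fun K => (T4RunLadder.unitFactorisation D hD g₀).A (pB K).K)
    (fun K => (T4RunLadder.unitFactorisation D hD g₀).measurable_A (pA K).K) (fun K => (T4RunLadder.unitFactorisation D hD g₀).measurable_A (pB K).K)
    (measurable_prodW _ os) (abs_prodW_le_one _ os) hP hQ hM hTV hw

end MassTVAtRecord

end Summit.QuantumFields.YangMills.BalabanUVNodes.N19ClassSandwichAtRecord

end
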